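/- Copyright: the b2b-balaban cell (near-miss cell 7), T⁴-continuum fan-out, lineage t4-ne7b-p1 (node U5c COUNT
member).  Released under the licence of the surrounding project. -/
import Summits.QuantumFields.BalabanUV.T4Continuum.Support.HistoryBankingFloors
import Summits.QuantumFields.BalabanUV.T4Continuum.Support.HistoryBankingBirthBookings
import Summits.QuantumFields.BalabanUV.T4Continuum.Support.HistoryBankingFlatLedger

/-!
# M5-1b (A3c, assembly) — THE FLAT ANCHOR LEDGER, END TO END: the weighted volume of a realised structure's maximal
realisation over the performed steps is below the booked life cost of its tagged genealogy plus the class-linear birth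
levels (owner module of row NE7b, lineage `t4-ne7b-p1` gen 43; re-open object (α), `SCOPE-alpha.md` v2.6, ruling
R-OWNER-43-1 «THE FLAT ANCHOR LEDGER» (d)(e); PRE-POSITIONING ONLY)

Summits-side support leaf of the T⁴-continuum cell (rung (B)+1 on a FINITE torus only; NOT infinite volume, NOT the
mass gap, NOT the Clay statement; NOT a proof of the spine estimate NE7b — the cell's OWN estimate, NOT PRINTED, NOT
PROVED).  [folklore] real arithmetic assembling the lineage's own bricks: A2 `HistoryBankingFlatLedger.flat_total_le`
(the lagged sum), A3b `HistoryBankingPedigreeLedger.perStep` (the per-step inequality along a realised pedigree), A3c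
`HistoryBankingFloors.sum_ncomp_floorK_le_lifeCost` (one performed floor per component-step),
`HistoryBankingBirthBookings.{sum_youngVol_le, sum_bsum_le_lifeCost, sum_recent_le_bfee, bfee_mul_le_sum_bsum}` (young
volume and fees against the births' bookings); nothing printed is asserted, no cite-tagged hypothesis, zero `sorry`.
One `def` (`nb`, the births within the lag — a recursive count).  B16 = [Balaban1989LargeFieldII] pp. 384–387 under
audit; locators only.

WHAT.  For a pedigree `P` realised along the run's flow (`RealisesW L s R P Z`; `L ≥ 4`, drop control on every horizon,
sizes `R ≥ 1`), a well-formed tagged genealogy `G` over labels `ε` with shape map `sh` whose shape-relabelling is `P`'s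
canonical genealogy (`relabel sh G = P.toGen` — the form in which the END's live member `q.2 = (ped K τ).genT c` sits over
the geometric pedigree `(ped K τ).toPGen (cellP K τ) c`, `HistoryGenBridge.toGen_toPGen`), pending at the cutoff
(`K < G.reach (dictWT sh R C.n₁)`), constants with `13 ≤ C.n₁`, `0 ≤ E₂, E₃`, per-step unit costs `u ≥ 0` with the growth
display `u (t+i) ≤ L_u·u t` (`i ≤ j`) and a lag `j ≥ 1` with `1122^d·16·21^d·L_u ≤ 2^{j−1}`:
§1 `nb j P m` (births `b` with `j_b ≤ m < j_b + j`), `= recent P (m−j) m` past the lag, `≥ #deadAnchors P m` before it,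
and its weighted sum `≤ j·L_u·bfee u P`; §2 **`flat_volume_le`** — under the RAW displays `u_t·Φ ≤ floorK C K R t`
(`t ≤ K`, any `Φ > 0`) and M5-1a's `u·5·126^d ≤ E₂R^{q′}`, `u·8·126^d ≤ E₃R^{q′}`:
`Σ_{m≤K} u_m·V(m) ≤ (2 + (2·561^d·j·L_u + 2·1122^d·L_u)∕Φ)·lifeCost (dictWT sh R C.n₁) (costT sh C K R) G + 2^{d+3}·blin u P`,
`V(m) = compSum id P m` the maximal volume; §3 **`flat_volume_le_lifeCost`** — the CALIBRATED form with coefficient ONE: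
under `u_t·6·(561^d·j·L_u + 1122^d·L_u) ≤ floorK C K R t`, `u·15·126^d ≤ E₂R^{q′}`, `u·24·126^d ≤ E₃R^{q′}` (the located
reading constants of the absorption repair in the END's currency),
`Σ_{m≤K} u_m·V(m) ≤ lifeCost (dictWT sh R C.n₁) (costT sh C K R) G + 2^{d+3}·blin u P` — THE COST SIDE OF THE TOTAL-FORM
BINDER for the flat volume form, the class-linear term `blin u P = Σ_b u_{j_b}(cls_b+1)` going to the credit-slack factor.

WHAT IS *NOT* DONE HERE.  M5-2: the witness's `κ K q` := the flat volume form (`u = log Λ K`), `priceM` from M2-B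
(`Λ^{#c.2} ≤` maximal volume, `HistoryBankingPedigreeMax.curDomain_subset_MDP`), and the plug into
`CountRoadWitnessT3bWT.cost_le` with `blin` routed through `HistoryConstantsTH.…_of_slack`.  HONEST: the lineage's own
bookkeeping; NE7b NOT proved; spine 0∕9.  HONEST DEPENDENCY (cell): continuum YM on T⁴ ⇐ BetaPertH ∧ nine spine estimates
(0∕9 proved); BetaPertH ⇐ (D1) ∧ (D4) ∧ CAP+tail.  This file changes none of it.
-/

open Finset
open Literature.MathematicalPhysics.QuantumFieldTheory.Balaban1983to89
open Literature.MathematicalPhysics.QuantumFieldTheory.Balaban1983to89.B13ScaleTransfer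
open Literature.MathematicalPhysics.QuantumFieldTheory.Balaban1983to89.B16SProfile
open Literature.MathematicalPhysics.QuantumFieldTheory.Balaban1983to89.B16StoppingRule
open T4PersistenceDictionary T4PrintedShapeBanking T4TaggedShapeBanking T4BankedInduction T4BranchingRecordsGas
open Summit.QuantumFields.BalabanUV.T4Continuum.HistoryAdmissible
open Summit.QuantumFields.BalabanUV.T4Continuum.HistoryRealise
open Summit.QuantumFields.BalabanUV.T4Continuum.HistoryRealiseWeak
open Summit.QuantumFields.BalabanUV.T4Continuum.HistoryBankingPedigreeMax
open Summit.QuantumFields.BalabanUV.T4Continuum.HistoryBankingPedigreeLedger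
open Summit.QuantumFields.BalabanUV.T4Continuum.HistoryBankingFloors
open Summit.QuantumFields.BalabanUV.T4Continuum.HistoryBankingBirthBookings
open Summit.QuantumFields.BalabanUV.T4Continuum.HistoryBankingFlatLedger

namespace Summit.QuantumFields.BalabanUV.T4Continuum.HistoryBankingFlatJunction

noncomputable section

open scoped Classical

variable {d : ℕ} {ε : Type*} [DecidableEq ε]

/-! ## §1 The births within the lag -/

section Lag

variable (j : ℕ)

/-- **THE BIRTHS WITHIN THE LAG**: the number of births `b` of the pedigree with `j_b ≤ m < j_b + j`. [folklore] -/
def nb : PGen (Pt d × Finset (Pt d)) → ℕ → ℕ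
  | .birth jb _ _, m => if jb ≤ m ∧ m < jb + j then 1 else 0
  | .renew G _, m => nb G m
  | .join X Y _, m => nb X m + nb Y m

variable {j}

/-- past the lag the births within the lag are A3b's recent births [folklore] -/
theorem nb_eq_recent {m : ℕ} (hjm : j ≤ m) : ∀ P : PGen (Pt d × Finset (Pt d)), nb j P m = recent P (m - j) m
  | .birth jb _ _ => by
      unfold nb recent
      by_cases h : jb ≤ m ∧ m < jb + j
      · rw [if_pos h, if_pos (by omega)]
      · rw [if_neg h, if_neg (by omega)]
  | .renew G _ => nb_eq_recent hjm G
  | .join X Y _ => by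
      change nb j X m + nb j Y m = recent X (m - j) m + recent Y (m - j) m
      rw [nb_eq_recent hjm X, nb_eq_recent hjm Y]

/-- before the lag every birth that has happened is within the lag, so the dead anchors are at most `nb` [folklore] -/
theorem card_deadAnchors_le_nb {L : ℕ} {s : ℕ → ℕ} {m : ℕ} (hmj : m < j) :
    ∀ P : PGen (Pt d × Finset (Pt d)), (deadAnchors L s P m).card ≤ nb j P m
  | .birth jb cls zZ => by
      unfold deadAnchors nb
      by_cases h : jb ≤ m ∧ ∃ i, i ≤ m - jb ∧ CondI 100 (orbit L s jb zZ.2 i)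
      · rw [if_pos h, if_pos ⟨h.1, by omega⟩, Finset.card_singleton]
      · rw [if_neg h]; simp
  | .renew G _ => card_deadAnchors_le_nb hmj G
  | .join X Y _ => by
      rw [deadAnchors_join]
      change _ ≤ nb j X m + nb j Y m
      exact (Finset.card_union_le _ _).trans (Nat.add_le_add (card_deadAnchors_le_nb hmj X)
        (card_deadAnchors_le_nb hmj Y))

/-- each birth is within the lag for `j` steps: `Σ_{m≤K} u_m·nb j P m ≤ j·L_u·bfee u P` under the growth display
[folklore] -/
theorem sum_nb_le_bfee {K : ℕ} {u : ℕ → ℝ} (hu : ∀ n, 0 ≤ u n) {Lu : ℝ}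
    (hLu : ∀ t i, i < j → u (t + i) ≤ Lu * u t) :
    ∀ P : PGen (Pt d × Finset (Pt d)), ∑ m ∈ Finset.range (K + 1), u m * (nb j P m : ℝ) ≤ j * Lu * bfee u P
  | .birth jb cls zZ => by
      have hterm : ∀ m ∈ Finset.range (K + 1), u m * (nb j (PGen.birth jb cls zZ) m : ℝ) ≤
          if m ∈ Finset.Ico jb (jb + j) then u m else 0 := by
        intro m _
        unfold nb
        by_cases hm : jb ≤ m ∧ m < jb + j
        · rw [if_pos hm, if_pos (by rw [Finset.mem_Ico]; omega)]; simp
        · rw [if_neg hm, if_neg (by rw [Finset.mem_Ico]; omega)]; simp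
      refine (Finset.sum_le_sum hterm).trans ?_
      rw [← Finset.sum_filter]
      calc ∑ m ∈ (Finset.range (K + 1)).filter (fun m => m ∈ Finset.Ico jb (jb + j)), u m
          ≤ ∑ m ∈ Finset.Ico jb (jb + j), u m :=
            Finset.sum_le_sum_of_subset_of_nonneg (fun m hm => (Finset.mem_filter.1 hm).2) fun m _ _ => hu m
        _ = ∑ i ∈ Finset.range j, u (jb + i) := by rw [Finset.sum_Ico_eq_sum_range, Nat.add_sub_cancel_left]
        _ ≤ ∑ i ∈ Finset.range j, Lu * u jb := Finset.sum_le_sum fun i hi => hLu jb i (Finset.mem_range.1 hi)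
        _ = j * Lu * bfee u (PGen.birth jb cls zZ) := by
            rw [Finset.sum_const, Finset.card_range, nsmul_eq_mul]; unfold bfee; ring
  | .renew G h => by
      have ih := sum_nb_le_bfee (K := K) hu hLu G
      have e1 : ∀ m, (nb j (PGen.renew G h) m : ℝ) = nb j G m := fun m => rfl
      simp only [e1]; exact ih
  | .join X Y sj => by
      have ihX := sum_nb_le_bfee (K := K) hu hLu X
      have ihY := sum_nb_le_bfee (K := K) hu hLu Y
      have e1 : ∀ m, u m * (nb j (PGen.join X Y sj) m : ℝ) = u m * (nb j X m : ℝ) + u m * (nb j Y m : ℝ) :=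
        fun m => by change u m * ((nb j X m + nb j Y m : ℕ) : ℝ) = _; push_cast; ring
      simp only [e1, Finset.sum_add_distrib]
      change _ ≤ j * Lu * (bfee u X + bfee u Y)
      linarith

end Lag

/-! ## §2 The flat ledger assembled -/

section Assembly

variable {L : ℕ} {s R : ℕ → ℕ} {C : T4PrintedShapeBanking.Consts} {sh : ε → PEv}

/-- linearity of A3b's component sums: `compSum (a·v + b) = a·compSum id + b·compSum 1` [folklore] -/
theorem compSum_affine (a b : ℝ) : ∀ (P : PGen (Pt d × Finset (Pt d))) (t : ℕ),
    compSum L s (fun v => a * (v : ℝ) + b) P t =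
      a * compSum L s (fun v => (v : ℝ)) P t + b * compSum L s (fun _ => (1 : ℝ)) P t
  | .birth jb cls zZ, t => by unfold compSum; split_ifs <;> ring
  | .renew G _, t => by unfold compSum; exact compSum_affine a b G t
  | .join X Y sj, t => by
      unfold compSum
      split_ifs
      · ring
      · rw [compSum_affine a b X t, compSum_affine a b Y t]; ring

/-- **BEFORE THE LAG**: for `m < j` the volume is young images plus `561^d` per birth within the lag (every birth that has
happened is within the lag; the cover of A3b component by component). [folklore] -/
theorem compSum_id_le_of_lt_lag (hL : 2 ≤ L) (hdrop : ∀ m, DropCtl s m) {j m : ℕ} (hmj : m < j) :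
    ∀ (P : PGen (Pt d × Finset (Pt d))) (Z : Finset (Pt d)), RealisesW L s R P Z →
      compSum L s (fun v => (v : ℝ)) P m ≤ youngVol L s P m + 561 ^ d * (nb j P m : ℝ)
  | P, Z, hP => by
      by_cases hlast : P.lastStep ≤ m
      · rw [compSum_of_le P (adm_of_realisesW P Z hP le_rfl) hlast]
        have h1 := card_MDP_le_young_add_dead hL hdrop hP m
        have h2 : ((deadAnchors L s P m).card : ℝ) ≤ (nb j P m : ℝ) := by
          exact_mod_cast card_deadAnchors_le_nb hmj P
        have h5 : (0 : ℝ) ≤ 561 ^ d := by positivity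
        nlinarith [mul_le_mul_of_nonneg_left h2 h5]
      · match P, hP with
        | .birth jb cls zZ, hP =>
            simp only [PGen.lastStep] at hlast
            have h0 : compSum L s (fun v => (v : ℝ)) (PGen.birth jb cls zZ) m = 0 := by
              unfold compSum; rw [if_neg hlast]
            rw [h0]
            have := youngVol_nonneg (L := L) (s := s) (PGen.birth jb cls zZ) m
            positivity
        | .renew Q h, hP =>
            obtain ⟨ZQ, hQ, -⟩ := hP
            have ih := compSum_id_le_of_lt_lag hL hdrop hmj Q ZQ hQ
            exact ih
        | .join X Y sj, hP =>
            simp only [PGen.lastStep] at hlast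
            obtain ⟨ZX, ZY, hX, hY, -⟩ := hP
            have ihX := compSum_id_le_of_lt_lag hL hdrop hmj X ZX hX
            have ihY := compSum_id_le_of_lt_lag hL hdrop hmj Y ZY hY
            have h0 : compSum L s (fun v => (v : ℝ)) (PGen.join X Y sj) m =
                compSum L s (fun v => (v : ℝ)) X m + compSum L s (fun v => (v : ℝ)) Y m := by
              conv_lhs => unfold compSum
              rw [if_neg hlast]
            rw [h0, youngVol_join]
            have hn : (nb j (PGen.join X Y sj) m : ℝ) = nb j X m + nb j Y m := by
              change ((nb j X m + nb j Y m : ℕ) : ℝ) = _; push_cast; ring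
            rw [hn]
            linarith

/-- **THE FLAT LEDGER ASSEMBLED (raw displays).**  Realised pedigree observed by the cutoff (`lastStep ≤ K`), well-formed
tagged genealogy over it pending at `K`, flow `L ≥ 4` with drop control, sizes `R ≥ 1`, allowance `C.n₁ ≥ 13`,
`E₂, E₃ ≥ 0`; unit costs `u ≥ 0` with growth `u (t+i) ≤ L_u·u t` (`i ≤ j`), a lag `j ≥ 1` with
`1122^d·16·21^d·L_u ≤ 2^j∕2`; displays `u_t·Φ ≤ floorK C K R t` (`t ≤ K`, `Φ > 0`) and M5-1a's two:
`Σ_{m≤K} u_m·V(m) ≤ (2 + (2·561^d·j·L_u + 2·1122^d·L_u)∕Φ)·lifeCost (dictWT sh R C.n₁) (costT sh C K R) G + 2^{d+3}·blin u P`.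
[folklore] -/
theorem flat_volume_le (hL : 4 ≤ L) (hdrop : ∀ m, DropCtl s m) (hR : ∀ t, 1 ≤ R t) (hn₁ : 13 ≤ C.n₁)
    (hE₂ : 0 ≤ C.E₂) (hE₃ : 0 ≤ C.E₃) {P : PGen (Pt d × Finset (Pt d))} {Z : Finset (Pt d)}
    (hP : RealisesW L s R P Z) {G : Gen ε} (hsh : relabel sh G = P.toGen) (hW : G.WF (dictWT sh R C.n₁)) {K : ℕ}
    (hPK : P.lastStep ≤ K) (hK : K < G.reach (dictWT sh R C.n₁)) {u : ℕ → ℝ} (hu : ∀ n, 0 ≤ u n) {Lu : ℝ}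
    (hLu0 : 0 ≤ Lu) {j : ℕ} (hj1 : 1 ≤ j) (hLu : ∀ t i, i ≤ j → u (t + i) ≤ Lu * u t)
    (hsmall : (1122 : ℝ) ^ d * 16 * 21 ^ d * Lu ≤ 2 ^ j / 2) {Φ : ℝ} (hΦ : 0 < Φ)
    (huΦ : ∀ t, t ≤ K → u t * Φ ≤ floorK C K R t)
    (huE₂ : ∀ n, n ≤ K → u n * (5 * 126 ^ d) ≤ C.E₂ * (R n : ℝ) ^ C.q')
    (huE₃ : ∀ n, n ≤ K → u n * (8 * 126 ^ d) ≤ C.E₃ * (R n : ℝ) ^ C.q') :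
    ∑ m ∈ Finset.range (K + 1), u m * compSum L s (fun v => (v : ℝ)) P m ≤
      (2 + (2 * 561 ^ d * j * Lu + 2 * 1122 ^ d * Lu) / Φ) * lifeCost (dictWT sh R C.n₁) (costT sh C K R) G
        + 2 ^ (d + 3) * blin u P := by
  set ε₀ : ℝ := 1122 ^ d * 16 * 21 ^ d / 2 ^ j with hε₀
  have hε0 : 0 ≤ ε₀ := by positivity
  have hA : P.Adm K := adm_of_realisesW P Z hP hPK
  -- (i) the per-step inequality in A2's shape
  have hstep : ∀ m, m ≤ K → compSum L s (fun v => (v : ℝ)) P m ≤ youngVol L s P m + (561 : ℝ) ^ d * (nb j P m : ℝ)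
      + (if j ≤ m then (1122 : ℝ) ^ d * compSum L s (fun _ => (1 : ℝ)) P (m - j)
          + ε₀ * compSum L s (fun v => (v : ℝ)) P (m - j) else 0) := by
    intro m _
    by_cases hjm : j ≤ m
    · rw [if_pos hjm]
      have h := perStep hL hdrop P Z hP (t := m - j) (m := m) (by omega)
      rw [show m - (m - j) = j by omega] at h
      have hlin := compSum_affine (L := L) (s := s)
        ((2 : ℝ) ^ d * (16 * 21 ^ d) / 2 ^ j) ((2 : ℝ) ^ d) P (m - j)
      have hfun : (fun v : ℕ => (2 : ℝ) ^ d * (16 * (21 ^ d * (v : ℝ)) / 2 ^ j + 1)) =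
          fun v : ℕ => (2 : ℝ) ^ d * (16 * 21 ^ d) / 2 ^ j * (v : ℝ) + 2 ^ d := by
        funext v; ring
      rw [hfun, hlin] at h
      rw [nb_eq_recent hjm]
      have h1122 : (561 : ℝ) ^ d * 2 ^ d = 1122 ^ d := by rw [← mul_pow]; norm_num
      have hεid : (561 : ℝ) ^ d * ((2 : ℝ) ^ d * (16 * 21 ^ d) / 2 ^ j) = ε₀ := by
        rw [hε₀]
        have : (561 : ℝ) ^ d * ((2 : ℝ) ^ d * (16 * 21 ^ d) / 2 ^ j) = (561 ^ d * 2 ^ d) * 16 * 21 ^ d / 2 ^ j := by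
          ring
        rw [this, h1122]
      have hexp : (561 : ℝ) ^ d * ((2 : ℝ) ^ d * (16 * 21 ^ d) / 2 ^ j * compSum L s (fun v => (v : ℝ)) P (m - j)
            + 2 ^ d * compSum L s (fun _ => (1 : ℝ)) P (m - j) + (recent P (m - j) m : ℝ))
          = ε₀ * compSum L s (fun v => (v : ℝ)) P (m - j) + 1122 ^ d * compSum L s (fun _ => (1 : ℝ)) P (m - j)
            + 561 ^ d * (recent P (m - j) m : ℝ) := by
        rw [← hεid, ← h1122]; ring
      linarith
    · rw [if_neg hjm, add_zero]
      exact compSum_id_le_of_lt_lag (show 2 ≤ L by omega) hdrop (by omega) P Z hP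
  -- (ii) the lagged sum
  have hsm : ε₀ * Lu ≤ 1 / 2 := by
    rw [hε₀]
    have h2 : (0 : ℝ) < 2 ^ j := by positivity
    rw [div_mul_eq_mul_div, div_le_iff₀ h2]
    linarith
  have hflat := flat_total_le (u := u) (V := fun m => compSum L s (fun v => (v : ℝ)) P m)
    (Y := fun m => youngVol L s P m) (N := fun m => compSum L s (fun _ => (1 : ℝ)) P m)
    (R := fun m => (nb j P m : ℝ)) (K := K) (j := j) (Lu := Lu) (cA := (561 : ℝ) ^ d) (cF := (1122 : ℝ) ^ d) (ε := ε₀)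
    hu (fun t => compSum_nonneg (fun v => Nat.cast_nonneg v) P t) (fun t => compSum_nonneg (fun _ => zero_le_one) P t)
    hLu0 (fun t => hLu t j le_rfl) (by positivity) hε0 hstep hsm
  -- (iii) the three terms against the bookings
  have hLC0 : 0 ≤ lifeCost (dictWT sh R C.n₁) (costT sh C K R) G :=
    lifeCost_nonneg (fun G n => costT_nonneg hE₂ hE₃ G n) G
  have hY := sum_youngVol_le (K := K) (C := C) (R := R) hL hdrop hR hE₂ hE₃ hu huE₂ huE₃ P Z hP
  have hB := sum_bsum_le_lifeCost (K := K) hE₂ hE₃ hsh hW hK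
  have hRc := sum_nb_le_bfee (K := K) (j := j) hu (fun t i hi => hLu t i hi.le) P
  have hF := bfee_mul_le_sum_bsum (K := K) hE₂ hE₃ huΦ hR P hA
  have hN : ∑ m ∈ Finset.range (K + 1), u m * compSum L s (fun _ => (1 : ℝ)) P m ≤
      lifeCost (dictWT sh R C.n₁) (costT sh C K R) G / Φ := by
    have h1 := sum_ncomp_floorK_le_lifeCost hL hdrop hR sh hn₁ hE₂ hE₃ K hP hsh hW hK
    rw [le_div_iff₀ hΦ, Finset.sum_mul]
    refine le_trans (Finset.sum_le_sum fun t ht => ?_) h1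
    rw [Finset.mem_range] at ht
    have hN0 := compSum_nonneg (L := L) (s := s) (fun _ => zero_le_one) P t
    calc u t * compSum L s (fun _ => (1 : ℝ)) P t * Φ = (u t * Φ) * compSum L s (fun _ => (1 : ℝ)) P t := by ring
      _ ≤ floorK C K R t * compSum L s (fun _ => (1 : ℝ)) P t := mul_le_mul_of_nonneg_right (huΦ t (by omega)) hN0
      _ = compSum L s (fun _ => (1 : ℝ)) P t * floorK C K R t := mul_comm _ _
  have hbfee : bfee u P ≤ lifeCost (dictWT sh R C.n₁) (costT sh C K R) G / Φ := by
    rw [le_div_iff₀ hΦ, mul_comm]; exact hF.trans hB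
  have hblin : 0 ≤ blin u P := blin_nonneg hu P
  -- (iv) arithmetic
  set LC := lifeCost (dictWT sh R C.n₁) (costT sh C K R) G with hLC
  have hj0 : (0 : ℝ) ≤ j := Nat.cast_nonneg j
  have t1 : (561 : ℝ) ^ d * ∑ m ∈ Finset.range (K + 1), u m * (nb j P m : ℝ) ≤ 561 ^ d * (j * Lu * (LC / Φ)) := by
    refine mul_le_mul_of_nonneg_left (hRc.trans ?_) (by positivity)
    exact mul_le_mul_of_nonneg_left hbfee (by positivity)
  have t2 : (1122 : ℝ) ^ d * Lu * ∑ m ∈ Finset.range (K + 1), u m * compSum L s (fun _ => (1 : ℝ)) P m ≤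
      1122 ^ d * Lu * (LC / Φ) := mul_le_mul_of_nonneg_left hN (by positivity)
  have t3 : ∑ m ∈ Finset.range (K + 1), u m * youngVol L s P m ≤ 2 ^ d * 4 * blin u P + LC := hY.trans (by linarith)
  have hfin : 2 * ((2 ^ d * 4 * blin u P + LC) + 561 ^ d * (j * Lu * (LC / Φ)) + 1122 ^ d * Lu * (LC / Φ)) =
      (2 + (2 * 561 ^ d * j * Lu + 2 * 1122 ^ d * Lu) / Φ) * LC + 2 ^ (d + 3) * blin u P := by
    rw [pow_add]; field_simp; ring
  linarith [hflat, t1, t2, t3, hfin.le]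

/-! ## §3 The calibrated form: coefficient one on the booked life cost -/

/-- **THE COST SIDE OF THE TOTAL-FORM BINDER FOR THE FLAT VOLUME FORM** (ruling R-OWNER-43-1, M5-1b).  Under the
CALIBRATED reading displays — `u_t·6·(561^d·j·L_u + 1122^d·L_u) ≤ floorK C K R t` (`t ≤ K`),
`u_n·15·126^d ≤ E₂R_n^{q′}`, `u_n·24·126^d ≤ E₃R_n^{q′}` (`n ≤ K`) — and the hypotheses of `flat_volume_le`:
`Σ_{m≤K} u_m·V(m) ≤ lifeCost (dictWT sh R C.n₁) (costT sh C K R) G + 2^{d+3}·blin u P`. [folklore] -/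
theorem flat_volume_le_lifeCost (hL : 4 ≤ L) (hdrop : ∀ m, DropCtl s m) (hR : ∀ t, 1 ≤ R t) (hn₁ : 13 ≤ C.n₁)
    (hE₂ : 0 ≤ C.E₂) (hE₃ : 0 ≤ C.E₃) {P : PGen (Pt d × Finset (Pt d))} {Z : Finset (Pt d)}
    (hP : RealisesW L s R P Z) {G : Gen ε} (hsh : relabel sh G = P.toGen) (hW : G.WF (dictWT sh R C.n₁)) {K : ℕ}
    (hPK : P.lastStep ≤ K) (hK : K < G.reach (dictWT sh R C.n₁)) {u : ℕ → ℝ} (hu : ∀ n, 0 ≤ u n) {Lu : ℝ}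
    (hLu0 : 0 < Lu) {j : ℕ} (hj1 : 1 ≤ j) (hLu : ∀ t i, i ≤ j → u (t + i) ≤ Lu * u t)
    (hsmall : (1122 : ℝ) ^ d * 16 * 21 ^ d * Lu ≤ 2 ^ j / 2)
    (huΦ : ∀ t, t ≤ K → u t * (6 * (561 ^ d * j * Lu + 1122 ^ d * Lu)) ≤ floorK C K R t)
    (huE₂ : ∀ n, n ≤ K → u n * (15 * 126 ^ d) ≤ C.E₂ * (R n : ℝ) ^ C.q')
    (huE₃ : ∀ n, n ≤ K → u n * (24 * 126 ^ d) ≤ C.E₃ * (R n : ℝ) ^ C.q') :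
    ∑ m ∈ Finset.range (K + 1), u m * compSum L s (fun v => (v : ℝ)) P m ≤
      lifeCost (dictWT sh R C.n₁) (costT sh C K R) G + 2 ^ (d + 3) * blin u P := by
  -- apply the raw form to `u′ := 3u` with `Φ := 2(561^d j L_u + 1122^d L_u)`: coefficient `2 + 1 = 3`
  set Φ : ℝ := 2 * (561 ^ d * j * Lu + 1122 ^ d * Lu) with hΦdef
  have hΦ : 0 < Φ := by rw [hΦdef]; positivity
  have hu' : ∀ n, 0 ≤ 3 * u n := fun n => by linarith [hu n]
  have hLu' : ∀ t i, i ≤ j → 3 * u (t + i) ≤ Lu * (3 * u t) := fun t i hi => by nlinarith [hLu t i hi]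
  have huΦ' : ∀ t, t ≤ K → 3 * u t * Φ ≤ floorK C K R t := fun t ht => by
    have := huΦ t ht; rw [hΦdef]; linarith
  have huE₂' : ∀ n, n ≤ K → 3 * u n * (5 * 126 ^ d) ≤ C.E₂ * (R n : ℝ) ^ C.q' := fun n hn => by
    have := huE₂ n hn; linarith
  have huE₃' : ∀ n, n ≤ K → 3 * u n * (8 * 126 ^ d) ≤ C.E₃ * (R n : ℝ) ^ C.q' := fun n hn => by
    have := huE₃ n hn; linarith
  have h := flat_volume_le (u := fun n => 3 * u n) hL hdrop hR hn₁ hE₂ hE₃ hP hsh hW hPK hK hu' hLu0.le hj1 hLu'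
    hsmall hΦ huΦ' huE₂' huE₃'
  have hcoef : (2 + (2 * 561 ^ d * j * Lu + 2 * 1122 ^ d * Lu) / Φ) = 3 := by
    rw [hΦdef]; field_simp; ring
  rw [hcoef] at h
  have hb : blin (fun n => 3 * u n) P = 3 * blin u P := blin_smul 3 u P
  have hs : ∑ m ∈ Finset.range (K + 1), 3 * u m * compSum L s (fun v => (v : ℝ)) P m =
      3 * ∑ m ∈ Finset.range (K + 1), u m * compSum L s (fun v => (v : ℝ)) P m := by
    rw [Finset.mul_sum]; exact Finset.sum_congr rfl fun m _ => by ring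
  rw [hb, hs] at h
  linarith

end Assembly

end

end Summit.QuantumFields.BalabanUV.T4Continuum.HistoryBankingFlatJunction
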